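import Literature.MathematicalPhysics.QuantumFieldTheory.FriotGreynatDeRafael2005.TwoRatioVacuumPolarization
import HarnessLib

/-!
# The 2020 White Paper's printed two-order expansion of the three-mass sixth-order term
`A₃⁽⁶⁾(m_μ/m_e, m_μ/m_τ)` — and its agreement with the Czarnecki–Skrzypek / Friot–Greynat–de Rafael
expansion (proved bookkeeping)

CITATION HEADER (venture `QEDPrecision`, cell `pub-qed`; typed PUBLISHED formulas only — this file
asserts no physics; it types ONE printed right-hand side and proves an algebraic identity between
printed forms).

HONEST FRAMING (verbatim, venture QEDPrecision): independent recomputation; certified where stated,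
statistical where stated; no new-physics claim.

Source: T. Aoyama et al., "The anomalous magnetic moment of the muon in the Standard Model",
Phys. Rept. 887 (2020) 1–166 = arXiv:2006.04822 [AoyamaEtAl2020], §7.3.2 (held text
`paper:arxiv-2006.04822` pp. 111–112), VERBATIM:
"The three-mass term `A₃⁽⁶⁾(m_μ/m_e, m_μ/m_τ)` appears for the first time at sixth order from the
diagram with two VP insertions shown in Fig. (6th-order)(b), see Ref. [Czarnecki:1998rc, Friot:2005cu,
Ananthanarayan:2020acj]:
```
A₃⁽⁶⁾(m_μ/m_e, m_μ/m_τ) = y⁻² ( −4/135 log x − 1/135 + 2/15 x² − 4π²/45 x³ )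
  + y⁻⁴ ( −229213/12348000 + π²/630 − 37/11025 log y − 1/105 log y log(y/x²) − 3/4900 log x )
  + O(y⁻⁶)
  = 0.000 527 738(75),
```
where `x = m_e/m_μ` and `y = m_τ/m_μ` and the uncertainty comes from the τ-lepton mass `m_τ`"
(`m_μ/m_e = 206.768 2827(47)`, `m_μ/m_τ = 5.946 35(40) × 10⁻²`, §7.3). [Czarnecki:1998rc] =
[CzarneckiSkrzypek1999]; [Friot:2005cu] = [FriotGreynatDeRafael2005].

Typed here:
* `a3SixMuEtauWP20 x y` — the display above through `y⁻⁴`, VERBATIM, WITHOUT the `O(y⁻⁶)` remainder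
  (`y⁻² := 1/y²`, `y⁻⁴ := 1/y⁴`; `log` = `Real.log`).
* `a3SixMuEtauWP20_eq_twoRatio` — PROVED: for `k, r > 0`, the Friot–Greynat–de Rafael expansion
  through `(m_μ²/m_τ²)⁴` (`a3SixVapTwoRatio k r`, squared-mass logarithms) equals this display at
  `x = 1/k`, `y = 1/r` plus exactly its printed `(m_μ²/m_τ²)³` and `(m_μ²/m_τ²)⁴` brackets — i.e. the
  two printings (single-mass-ratio logarithms `log x`, `log y`, `log(y/x²)` versus `ln(m_τ²/m_μ²)
  ln(m_τ²m_μ²/m_e⁴)`, `ln(m_τ²/m_e²)`, `ln(m_μ²/m_e²)`) agree coefficient by coefficient through `y⁻⁴`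
  (e.g. `−3/4900 = 2(1/504 − 37/22050)·(−1)`, `−1/105 log y log(y/x²) = −1/420 · ln(m_τ²/m_μ²)
  ln(m_τ²m_μ²/m_e⁴)`) — a transcription cross-check carried by the kernel.
Deliberately NOT here: the printed decimal `0.000 527 738(75)` (it depends on measured mass ratios, and
per the White Paper's references may include the refinements of [Ananthanarayan:2020acj] beyond this
display; the cell evaluates the typed expansions at printed central ratios in the kernel under
`Summits/Ventures/QEDPrecision/Certificates/` and compares there); anything about `a_μ` itself.
-/

noncomputable section

open Real

namespace Literature.MathematicalPhysics.QuantumFieldTheory.AoyamaEtAl2020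

open Literature.MathematicalPhysics.QuantumFieldTheory.FriotGreynatDeRafael2005 (a3SixVapTwoRatio
  a3SixVapTwoRatio_eq_log_form)

/-- [AoyamaEtAl2020] §7.3.2, the printed two-order expansion of the three-mass sixth-order muon term
`A₃⁽⁶⁾(m_μ/m_e, m_μ/m_τ)` in `x = m_e/m_μ`, `y = m_τ/m_μ`, VERBATIM, WITHOUT its `O(y⁻⁶)` remainder
(`y⁻ⁿ` written `1/yⁿ`):
`y⁻²(−4/135 log x − 1/135 + 2/15 x² − 4π²/45 x³)
 + y⁻⁴(−229213/12348000 + π²/630 − 37/11025 log y − 1/105 log y log(y/x²) − 3/4900 log x)`.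
[cite: AoyamaEtAl2020, §7.3.2] -/
def a3SixMuEtauWP20 (x y : ℝ) : ℝ :=
  1 / y ^ 2 * (-(4 / 135 * log x) - 1 / 135 + 2 / 15 * x ^ 2 - 4 * π ^ 2 / 45 * x ^ 3)
    + 1 / y ^ 4 * (-(229213 / 12348000) + π ^ 2 / 630 - 37 / 11025 * log y
        - 1 / 105 * log y * log (y / x ^ 2) - 3 / 4900 * log x)

/-! ### Proved bookkeeping: the two printings agree through `y⁻⁴ = (m_μ/m_τ)⁴` -/

/-- **White Paper display = Czarnecki–Skrzypek / Friot–Greynat–de Rafael expansion through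
`(m_μ²/m_τ²)²`.** For `k = m_μ/m_e > 0`, `r = m_μ/m_τ > 0`: `a3SixVapTwoRatio k r`
([FriotGreynatDeRafael2005] §5, through `(m_μ²/m_τ²)⁴`) equals `a3SixMuEtauWP20 (1/k) (1/r)` plus the
printed `(m_μ²/m_τ²)³` and `(m_μ²/m_τ²)⁴` brackets of the former. Pure algebra after expressing every
logarithm through `log k`, `log r`; nothing printed is altered.
[cite: AoyamaEtAl2020, §7.3.2] [cite: FriotGreynatDeRafael2005, §5 closing display] -/
theorem a3SixMuEtauWP20_eq_twoRatio {k r : ℝ} (hk : 0 < k) (hr : 0 < r) :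
    a3SixVapTwoRatio k r =
      a3SixMuEtauWP20 (1 / k) (1 / r)
        + (r ^ 2) ^ 3 * (-(2 / 945) * log (1 / r ^ 2) * log (k ^ 4 / r ^ 2)
            - 199 / 297675 * log (k ^ 2 / r ^ 2) - 1 / 4725 * log (k ^ 2) + 4 * π ^ 2 / 2835
            - 1102961 / 75014100)
        + (r ^ 2) ^ 4 * (-(1 / 594) * log (1 / r ^ 2) * log (k ^ 4 / r ^ 2)
            - 391 / 2058210 * log (k ^ 2 / r ^ 2) - 19 / 31185 * log (k ^ 2) + π ^ 2 / 891
            - 161030983 / 14263395300) := by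
  have hk2 : log (k ^ 2) = 2 * log k := by
    rw [Real.log_pow]; norm_num
  have hr2 : log (1 / r ^ 2) = -(2 * log r) := by
    rw [one_div, Real.log_inv, Real.log_pow]; norm_num
  have hkr : log (k ^ 4 / r ^ 2) = 4 * log k - 2 * log r := by
    rw [Real.log_div (by positivity) (by positivity), Real.log_pow, Real.log_pow]; norm_num
  have hkr2 : log (k ^ 2 / r ^ 2) = 2 * log k - 2 * log r := by
    rw [Real.log_div (by positivity) (by positivity), Real.log_pow, Real.log_pow]; norm_num
  have hx : log (1 / k) = -log k := by rw [one_div, Real.log_inv]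
  have hy : log (1 / r) = -log r := by rw [one_div, Real.log_inv]
  have hyx : log (1 / r / (1 / k) ^ 2) = 2 * log k - log r := by
    rw [show 1 / r / (1 / k) ^ 2 = k ^ 2 / r by field_simp,
      Real.log_div (by positivity) (by positivity), Real.log_pow]
    norm_num
  have hik : 1 / (1 / r) ^ 2 = r ^ 2 := by field_simp
  have hik4 : 1 / (1 / r) ^ 4 = r ^ 4 := by field_simp
  rw [a3SixVapTwoRatio_eq_log_form hk hr]
  unfold a3SixMuEtauWP20
  rw [hr2, hkr, hkr2, hk2, hx, hy, hyx, hik, hik4]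
  field_simp
  ring

end Literature.MathematicalPhysics.QuantumFieldTheory.AoyamaEtAl2020

end
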